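import Summits.QuantumFields.YangMills.Theorems.BalabanUVNodesPortS1FlatKernel
import Summits.QuantumFields.YangMills.Theorems.BalabanUVNodesPortS1PhiLZLogDet
import Summits.QuantumFields.YangMills.Theorems.BalabanUVNodesPortS1Selector
import Literature.MathematicalPhysics.QuantumFieldTheory.Balaban1983to89.Node00.ShearedAveragingRecord

/-!
# NODE O port PT-A — THE BASE POINT OF `phiLZ` IS THE FLAT BACKGROUND: `V^{(k)}_{ax}(W_0) = 1` (`portVkAx … 0 = 1`), so at `B = 0` the letters of `…PhiLZLogDet` ∕ `…ZkGraph` are the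
# flat-background THEOREMS of `…FlatLetter` ∕ `…FlatKernel` (the `b₀`-block is invertible; the dimension match holds); `phiLZ_eq_logDet_sum₀` = the two-bracket form with the `B = 0` letter discharged

Cell `ym-nodeO-ideate`, porter seat `ymgap-nodeO-port-PTA-1` (gen 4); `--supports stmt-QuantumFields-27930` (helper).  [I] = [Balaban1987RG1].
* `critCfgAxOfRecord_one` — `V^{(k)}_{ax}(1) = 1` (both branches of def-B's `Uk`: the axialised `k`-fold average of a flat minimiser, `axialize` of the unit field by `axialGauge_contourOfRecord_one`);
  `portVkAx_zero`; `recordB0BlockInvertible_portVkAx_zero`; ★ `phiLZ_eq_logDet_sum₀`.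

HONEST FRAMING.  Bookkeeping at the base point; NOTHING of Bałaban asserted∕ported∕discharged; positivity still displayed; 27930 OPEN; K0⁷∕K-Ax OPEN; NODE O 0∕1; COUNT 8∕28 · K 1∕4 UNMOVED; finite `𝕋⁴_{L^K}` at
fixed ε — NOT continuum ∕ OS ∕ Clay; **the Yang–Mills mass gap is NOT proved by any of this.**  No `sorry`, no `def`, no `instance`; standard axioms.
-/

noncomputable section

open scoped BigOperators Matrix.Norms.L2Operator Topology

namespace Summit.QuantumFields.YangMills.Theorems.BalabanUVNodesPortS1

open Summit.QuantumFields.YangMills.Theorems.K0RecordFormatNames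
open Summit.QuantumFields.YangMills.BalabanUVNodes.N09FlatSectorUniqueness
open Literature.MathematicalPhysics.QuantumFieldTheory.Balaban1983to89
open Literature.MathematicalPhysics.QuantumFieldTheory.Balaban1983to89.Node00
open Literature.MathematicalPhysics.QuantumFieldTheory.Balaban1983to89.T4Continuum (T4Family)
open Literature.MathematicalPhysics.QuantumFieldTheory.Balaban1983to89.BlockAxialRepresentative (axialize axialize_eq_self_of_axialGauge)
open _root_.Matrix

variable (F : T4Family)

/-- **`V^{(k)}_{ax}(1) = 1`**: the block-axial `k`-fold average of the minimiser over the unit coarse field is the unit field (on the solvable branch: any minimiser over `1` is gauge-equivalent to `1`,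
`critCfgAxOfRecord_eq_of_isBackground` with `U₀ = 1`; off it def-B's `Uk` defaults to `1`; then `M^k(1) = 1` and the unit field is already block-axial). [cite: Balaban1987RG1, (2.2)–(2.3) p.265] -/
theorem critCfgAxOfRecord_one (ν : Stage7Numerics) (K k : ℕ) (hk : k + 1 ≤ (F.P K).m + (F.P K).K) :
    critCfgAxOfRecord F 2 ν K k (1 : GaugeField (F.P K) (k + 1) (SU 2)) = 1 := by
  have hax : axialize (contourOfRecord F 2 K k) (1 : GaugeField (F.P K) k (SU 2)) = 1 :=
    axialize_eq_self_of_axialGauge hk _ (axialGauge_contourOfRecord_one F 2 K k)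
  by_cases h : UkExists F 2 K (k + 1) ν.εreg (1 : GaugeField (F.P K) (k + 1) (SU 2))
  · obtain ⟨U₀, hU₀⟩ := h
    have hmem : (1 : GaugeField (F.P K) 0 (SU 2)) ∈ bgReg F 2 K (k + 1) ν.εreg :=
      mem_bgReg_of_flat_of_mem (F := F) (N := 2) (flat_one (P := F.P K) (j := 0)) hU₀.2.1
    have hbg : IsBackground (avOfRecord F 2 K) (bgReg F 2 K (k + 1) ν.εreg) (k + 1) (1 : GaugeField (F.P K) (k + 1) (SU 2)) 1 := by
      have h1 := isBackground_of_flat (F := F) (N := 2) (k := k + 1) (flat_one (P := F.P K) (j := 0)) hmem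
      rwa [B15Claim189UnitTestAtRecord.iter_avOfRecord_one F 2 K (k + 1)] at h1
    rw [critCfgAxOfRecord_eq_of_isBackground (by omega) (uniqueUkOrbit_one (F := F) (N := 2) (by omega) ν.εreg) hbg,
      B15Claim189UnitTestAtRecord.iter_avOfRecord_one F 2 K k, hax]
  · rw [critCfgAxOfRecord_def, critCfgOfRecord_def, Uk_of_not h, B15Claim189UnitTestAtRecord.iter_avOfRecord_one F 2 K k, hax]

/-- **The base point of the chart is the flat background**: `portVkAx F a₀ ε₂₉ k K 0 = 1`. [cite: Balaban1987RG1, (2.3) p.265, p.264 (before (1.20))] -/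
theorem portVkAx_zero (a₀ ε₂₉ : ℝ) (k K : ℕ) (hk : k + 1 ≤ (F.P K).m + (F.P K).K) :
    letI θ := thetaFill F a₀ ε₂₉; letI := θ.instVβ₁; letI := θ.instVβ₂
    portVkAx F a₀ ε₂₉ k K 0 = 1 := by
  rw [portVkAx, unitField_zero]
  exact critCfgAxOfRecord_one F _ K k hk

open Classical in
/-- The letter at the base point of `phiLZ`. [cite: Balaban1987RG1, p.267] -/
theorem recordB0BlockInvertible_portVkAx_zero (a₀ ε₂₉ : ℝ) (k K : ℕ) (hk : k + 1 ≤ (F.P K).m + (F.P K).K) :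
    letI θ := thetaFill F a₀ ε₂₉; letI := θ.instVβ₁; letI := θ.instVβ₂
    RecordB0BlockInvertible F k K (portVkAx F a₀ ε₂₉ k K 0) := by
  rw [portVkAx_zero F a₀ ε₂₉ k K hk]
  exact recordB0BlockInvertible_one F k K hk

open Classical in
/-- ★ **`Φ₁` IN TWO BRACKETS AT THE TEXTS' VOLUMES, the `B = 0` letter DISCHARGED**: under the letter at `W_B` and positivity at `W_B` and `W_0`,
`phiLZ n B = −½[log det T(B) − log det T(0)] − Σ_c [log|det A₁(c)(B)| − log|det A₁(c)(0)|]`. [cite: Balaban1987RG1, (2.12) p.268, (1.4) p.260, p.267] -/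
theorem phiLZ_eq_logDet_sum₀ (Mc : ℕ) (a₀ ε₂₉ : ℝ) (k n : ℕ) (B : recordW F a₀ ε₂₉ k (recordK₀ F Mc k + n))
    (hA : RecordB0BlockInvertible F k (recordK₀ F Mc k + n) (portVkAx F a₀ ε₂₉ k (recordK₀ F Mc k + n) B))
    (hP : (recordPreckLoc F k (recordK₀ F Mc k + n) (thetaFill F a₀ ε₂₉).εbg (portVkAx F a₀ ε₂₉ k (recordK₀ F Mc k + n) B)
      (hopLinGraph F k (recordK₀ F Mc k + n) (portVkAx F a₀ ε₂₉ k (recordK₀ F Mc k + n) B))).PosDef)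
    (hP₀ : letI θ := thetaFill F a₀ ε₂₉; letI := θ.instVβ₁; letI := θ.instVβ₂;
      (recordPreckLoc F k (recordK₀ F Mc k + n) (thetaFill F a₀ ε₂₉).εbg (portVkAx F a₀ ε₂₉ k (recordK₀ F Mc k + n) 0)
        (hopLinGraph F k (recordK₀ F Mc k + n) (portVkAx F a₀ ε₂₉ k (recordK₀ F Mc k + n) 0))).PosDef) :
    letI θ := thetaFill F a₀ ε₂₉; letI := θ.instVβ₁; letI := θ.instVβ₂;
    phiLZ F Mc a₀ ε₂₉ k n B =
      ((-(1 / 2 : ℝ) * (Real.log (recordPreckLoc F k (recordK₀ F Mc k + n) (thetaFill F a₀ ε₂₉).εbg (portVkAx F a₀ ε₂₉ k (recordK₀ F Mc k + n) B)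
            (hopLinGraph F k (recordK₀ F Mc k + n) (portVkAx F a₀ ε₂₉ k (recordK₀ F Mc k + n) B))).det
          - Real.log (recordPreckLoc F k (recordK₀ F Mc k + n) (thetaFill F a₀ ε₂₉).εbg (portVkAx F a₀ ε₂₉ k (recordK₀ F Mc k + n) 0)
            (hopLinGraph F k (recordK₀ F Mc k + n) (portVkAx F a₀ ε₂₉ k (recordK₀ F Mc k + n) 0))).det)
        - ∑ c : PBond (F.P (recordK₀ F Mc k + n)) (k + 1),
            (Real.log |(Matrix.of fun j j' : Fin 3 => recordLQtB0 F k (recordK₀ F Mc k + n) (portVkAx F a₀ ε₂₉ k (recordK₀ F Mc k + n) B) (c, j) (c, j')).det|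
              - Real.log |(Matrix.of fun j j' : Fin 3 => recordLQtB0 F k (recordK₀ F Mc k + n) (portVkAx F a₀ ε₂₉ k (recordK₀ F Mc k + n) 0) (c, j) (c, j')).det|) : ℝ) : ℂ) :=
  phiLZ_eq_logDet_sum F Mc a₀ ε₂₉ k n B hA (recordB0BlockInvertible_portVkAx_zero F a₀ ε₂₉ k _ (succ_le_m_add_K_recordK₀ F Mc k n)) hP hP₀

end Summit.QuantumFields.YangMills.Theorems.BalabanUVNodesPortS1

end
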